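import Summits.QuantumFields.BalabanUV.T4Continuum.Support.NE3EnergyPathC2
import Summits.QuantumFields.BalabanUV.T4Continuum.Support.AveragingDeficitNearIdentity

/-!
# T⁴ programme, node NE3, route P2 «ENERGY CONVEXITY» — row S5-Y8 PART 1 = typer sub-row S5-Y8a (norm-free plumbing): the Wilson Hessian
# `NE3HessForm.hess V · · W` as an `ℝ`-BILINEAR MAP `hessBilin V W`, its symmetrisation `hessSym V W` (the `Hs t` of
# `NE3EnergyAssembly.RouteLeaves`), and the dictionary discharging the fields `act ∕ d1 ∕ d2 ∕ symm ∕ split` TOGETHER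
# from leaf L3 (`Support/NE3EnergyPathC2`) along a general C² path, and `res` from row Y9's output shape

NE3 formalisation swarm, leaf seat `b2b-balaban-t4-ne3-formalise-leaf-03` (gen 3), row S5∕S6 sub-row S5-Y8 PART 1 of
`HOME/t4/formal/NE3/LEAVES.md` (road P2 leaf L8 «torus instance», skeleton `HOME/t4/skeletons/NE3-t4-ne3-p2.md` §2A: «plug
the concrete `Hs t`, `u t`, `e t` of L3–L7»).  WHY.  `RouteLeaves` (p213345) carries the Hessian forms as BILINEAR MAPS
`Hs : ℝ → (Site d → Fin d → Matrix n n ℂ) →ₗ[ℝ] (Site d → Fin d → Matrix n n ℂ) →ₗ[ℝ] ℝ` with `symm : Hs t x y = Hs t y x`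
and `split : φ″ t = Hs t (X + uu t) (X + uu t) + e t`, while the tree's concrete second variation `NE3HessForm.hess V X Y W`
(p212889) is a plain function, not symmetric in `(X, Y)` away from critical `V`.  THIS FILE (all [folklore] algebra):
§1 linearity of `Ad` and of the dressed curl `curlAt V · p` in the direction field, BILINEARITY of `dcurlAt V · · p`,
   `hessPlaqAt V · · p` and `hess V · · W` in the two direction slots (`ℝ`-scalars);
§2 **`hessBilin V W`** (`hessBilin V W X Y = hess V X Y W`, `LinearMap.mk₂`) and its symmetrisation **`hessSym V W`**
   (`hessSym V W X Y = (hess V X Y W + hess V Y X W)/2`; `hessSym_symm`; `hessSym_self : hessSym V W X X = hess V X X W`);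
§3 **`c2_split_fields`**: along a general path `t ↦ W_t := W·exp Γ(t)` with velocity data `(Ψ, Ψ′)` (the hypotheses
   `hE`∕`hΨ` of `NE3EnergyPathC2.hasDerivAt_two_fineAction_path`, dischargeable by `NE3EnergyPathC2Velocity`), and for ANY
   tangent datum `X`, the five fields `act ∕ d1 ∕ d2 ∕ symm ∕ split` of `RouteLeaves` hold VERBATIM with
   `φ t := A_{Wn}(W_t)`, `φ′ t := dAction W_t (Ψ t) Wn`, `φ″ t := hess W_t (Ψ t) (Ψ t) Wn + dAction W_t (Ψ′ t) Wn`,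
   `Hs t := hessSym W_t Wn`, `uu t := Ψ t − X`, `e t := dAction W_t (Ψ′ t) Wn` (take `W := cavg L U_B`,
   `Wn := perWin d (N·L^k)` for the torus assembly);
§4 **`res_field`** ∕ `res_field_of_endW`: the field `res : φ′ 1 ≤ r·E` from ANY bound of row Y9's output shape
   («`∀ D, HasDerivAt (s ↦ A_{Wn}(W e^{sΨ_1})) D 0 → |D| ≤ r·E`», `NE3EnergyResidual.abs_deriv_action_le_residualScale`
   with `X := Ψ 1 = Γ′(1)`), since `φ′ 1 = dAction W (Ψ 1) Wn` is such a derivative (`hasDerivAt_fineAction_vary_at`).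
NOT IN THIS PART (carried binders, untouched): `coer` (L5), `cont` (L6), `curv` (L7), `velocity`∕`close` (L2(b)) — in
particular NO k-uniform tangent coercivity is stated or consumed in any norm (typer ρ19 ∕ GAPS G-ne7king10-1: the norm of
E-L5 is the single writers' call).  The companion file `Support/NE3EnergyHessCont` (PART 1b) discharges `cont` — for ALL
directions, via the periodised form `HsPer := hessSym ∘ (perExt × perExt)` — and reduces `curv` to the chart's acceleration
bound; the coercivity-consuming torus instance of `NE3EnergyPath.energyResponse_of_pathData` is S5-Y8b (HELD, ρ19).

HONEST FRAMING.  Finite-T⁴ bookkeeping (rung (B)+1); linear algebra and calculus plumbing; NOTHING about Bałaban's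
minimisers is asserted; NE3 NOT proved («NE3-E CONDITIONAL on ⟨named structures⟩» unchanged); spine PROVED 0∕9; no
conditional of the cell (`BetaPertH`, (B), G-an2-4) used or hidden; NOT infinite volume ∕ mass gap ∕ Clay ∕ summit
progress.  ABSOLUTE RULE kept: no printed sentence is a hypothesis (context: [Balaban1985Variational] (26)–(27) p. 282;
[Balaban1985BackgroundPropagators] (3.10) p. 391).  PLACEMENT: `Summits/QuantumFields/BalabanUV/`; imports
`Support.NE3EnergyPathC2` (p213685; hence `NE3HessForm` p212889) and `Support.AveragingDeficitNearIdentity` (`Ad_add`) BY NAME; restates nothing, moves nothing; TWO data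
definitions (`hessBilin`, `hessSym`: bilinear-map packagings), no `def … : Prop`.
-/

set_option autoImplicit false

open scoped BigOperators Matrix.Norms.L2Operator
open NormedSpace Finset

namespace Summit.QuantumFields.BalabanUV.T4Continuum.NE3EnergyHessBilin

open Literature.MathematicalPhysics.QuantumFieldTheory.Balaban1983to89
open B7Prop1Explicit B7Prop2Explicit MatrixLog UnitaryModel
open T4AveragingDeficitWall hiding Site Plane Plaq Bond
open T4AveragingDeficitNonAbelian (Ad_sub)
open AveragingDeficitNearIdentity (Ad_add)
open NE3HessForm (dcurlAt dcurl dAction hessPlaqAt hessPlaq hess)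
open NE3EnergyPathC2 (hasDerivAt_two_fineAction_path)

noncomputable section

variable {d : ℕ} {n : Type*} [Fintype n] [DecidableEq n]

/-! ## §1 Linearity of `Ad`, `curlAt`; bilinearity of `dcurlAt`, `hessPlaqAt`, `hess` -/

/-- `Ad_u (c • X) = c • Ad_u X` for REAL `c` (the tree's `AveragingDeficitNearIdentity.Ad_smul` is the `ℂ`-scalar
version; `Ad_add` ∕ `Ad_sub` are used BY NAME from `AveragingDeficitNearIdentity` ∕ `T4AveragingDeficitNonAbelian`).
[folklore] -/
theorem Ad_real_smul (u : (Matrix n n ℂ)ˣ) (c : ℝ) (X : Matrix n n ℂ) : Ad u (c • X) = c • Ad u X := by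
  unfold Ad; rw [mul_smul_comm, smul_mul_assoc]

/-- The dressed curl is ADDITIVE in the direction field. [folklore] -/
theorem curlAt_add (V : Site d → Fin d → (Matrix n n ℂ)ˣ) (X Y : Site d → Fin d → Matrix n n ℂ) (z : Site d) (μ ν : Fin d) :
    curlAt V (X + Y) z μ ν = curlAt V X z μ ν + curlAt V Y z μ ν := by
  simp only [curlAt, Pi.add_apply, Ad_add]
  abel

/-- The dressed curl is `ℝ`-HOMOGENEOUS in the direction field. [folklore] -/
theorem curlAt_smul (V : Site d → Fin d → (Matrix n n ℂ)ˣ) (c : ℝ) (X : Site d → Fin d → Matrix n n ℂ) (z : Site d)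
    (μ ν : Fin d) : curlAt V (c • X) z μ ν = c • curlAt V X z μ ν := by
  simp only [curlAt, Pi.smul_apply, Ad_real_smul, smul_add, smul_sub]

/-- `dcurlAt V X Y` is additive in `X`. [folklore] -/
theorem dcurlAt_add_left (V : Site d → Fin d → (Matrix n n ℂ)ˣ) (X₁ X₂ Y : Site d → Fin d → Matrix n n ℂ) (z : Site d)
    (μ ν : Fin d) : dcurlAt V (X₁ + X₂) Y z μ ν = dcurlAt V X₁ Y z μ ν + dcurlAt V X₂ Y z μ ν := by
  simp only [dcurlAt, Pi.add_apply, add_mul, mul_add, sub_mul, mul_sub, add_sub_add_comm, Ad_add, Ad_sub]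
  abel

/-- `dcurlAt V X Y` is additive in `Y`. [folklore] -/
theorem dcurlAt_add_right (V : Site d → Fin d → (Matrix n n ℂ)ˣ) (X Y₁ Y₂ : Site d → Fin d → Matrix n n ℂ) (z : Site d)
    (μ ν : Fin d) : dcurlAt V X (Y₁ + Y₂) z μ ν = dcurlAt V X Y₁ z μ ν + dcurlAt V X Y₂ z μ ν := by
  simp only [dcurlAt, Pi.add_apply, add_mul, mul_add, sub_mul, mul_sub, Ad_add, Ad_sub]
  abel

/-- `dcurlAt V X Y` is `ℝ`-homogeneous in `X`. [folklore] -/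
theorem dcurlAt_smul_left (V : Site d → Fin d → (Matrix n n ℂ)ˣ) (c : ℝ) (X Y : Site d → Fin d → Matrix n n ℂ)
    (z : Site d) (μ ν : Fin d) : dcurlAt V (c • X) Y z μ ν = c • dcurlAt V X Y z μ ν := by
  simp only [dcurlAt, Pi.smul_apply, smul_mul_assoc, mul_smul_comm, ← smul_sub, Ad_real_smul, ← smul_add]

/-- `dcurlAt V X Y` is `ℝ`-homogeneous in `Y`. [folklore] -/
theorem dcurlAt_smul_right (V : Site d → Fin d → (Matrix n n ℂ)ˣ) (c : ℝ) (X Y : Site d → Fin d → Matrix n n ℂ)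
    (z : Site d) (μ ν : Fin d) : dcurlAt V X (c • Y) z μ ν = c • dcurlAt V X Y z μ ν := by
  simp only [dcurlAt, Pi.smul_apply, smul_mul_assoc, mul_smul_comm, ← smul_sub, Ad_real_smul, ← smul_add]

/-- `hessPlaqAt V X Y` is additive in `X`. [folklore] -/
theorem hessPlaqAt_add_left (V : Site d → Fin d → (Matrix n n ℂ)ˣ) (X₁ X₂ Y : Site d → Fin d → Matrix n n ℂ) (z : Site d)
    (μ ν : Fin d) : hessPlaqAt V (X₁ + X₂) Y z μ ν = hessPlaqAt V X₁ Y z μ ν + hessPlaqAt V X₂ Y z μ ν := by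
  simp only [hessPlaqAt, dcurlAt_add_left, curlAt_add, mul_add, add_mul, ← nReTrL_apply, map_add, neg_add]
  abel

/-- `hessPlaqAt V X Y` is additive in `Y`. [folklore] -/
theorem hessPlaqAt_add_right (V : Site d → Fin d → (Matrix n n ℂ)ˣ) (X Y₁ Y₂ : Site d → Fin d → Matrix n n ℂ) (z : Site d)
    (μ ν : Fin d) : hessPlaqAt V X (Y₁ + Y₂) z μ ν = hessPlaqAt V X Y₁ z μ ν + hessPlaqAt V X Y₂ z μ ν := by
  simp only [hessPlaqAt, dcurlAt_add_right, curlAt_add, add_mul, ← nReTrL_apply, map_add, neg_add]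
  abel

/-- `hessPlaqAt V X Y` is `ℝ`-homogeneous in `X`. [folklore] -/
theorem hessPlaqAt_smul_left (V : Site d → Fin d → (Matrix n n ℂ)ˣ) (c : ℝ) (X Y : Site d → Fin d → Matrix n n ℂ)
    (z : Site d) (μ ν : Fin d) : hessPlaqAt V (c • X) Y z μ ν = c * hessPlaqAt V X Y z μ ν := by
  simp only [hessPlaqAt, dcurlAt_smul_left, curlAt_smul, mul_smul_comm, ← smul_add, smul_mul_assoc, ← nReTrL_apply,
    map_smul, smul_eq_mul, mul_neg]

/-- `hessPlaqAt V X Y` is `ℝ`-homogeneous in `Y`. [folklore] -/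
theorem hessPlaqAt_smul_right (V : Site d → Fin d → (Matrix n n ℂ)ˣ) (c : ℝ) (X Y : Site d → Fin d → Matrix n n ℂ)
    (z : Site d) (μ ν : Fin d) : hessPlaqAt V X (c • Y) z μ ν = c * hessPlaqAt V X Y z μ ν := by
  simp only [hessPlaqAt, dcurlAt_smul_right, curlAt_smul, smul_mul_assoc, ← smul_add, ← nReTrL_apply, map_smul,
    smul_eq_mul, mul_neg]

/-- `hess V X Y W` is additive in `X`. [folklore] -/
theorem hess_add_left (V : Site d → Fin d → (Matrix n n ℂ)ˣ) (W : Finset (T4AveragingDeficitWall.Plaq d))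
    (X₁ X₂ Y : Site d → Fin d → Matrix n n ℂ) : hess V (X₁ + X₂) Y W = hess V X₁ Y W + hess V X₂ Y W := by
  simp only [hess, hessPlaq, hessPlaqAt_add_left, Finset.sum_add_distrib]

/-- `hess V X Y W` is additive in `Y`. [folklore] -/
theorem hess_add_right (V : Site d → Fin d → (Matrix n n ℂ)ˣ) (W : Finset (T4AveragingDeficitWall.Plaq d))
    (X Y₁ Y₂ : Site d → Fin d → Matrix n n ℂ) : hess V X (Y₁ + Y₂) W = hess V X Y₁ W + hess V X Y₂ W := by
  simp only [hess, hessPlaq, hessPlaqAt_add_right, Finset.sum_add_distrib]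

/-- `hess V X Y W` is `ℝ`-homogeneous in `X`. [folklore] -/
theorem hess_smul_left (V : Site d → Fin d → (Matrix n n ℂ)ˣ) (W : Finset (T4AveragingDeficitWall.Plaq d)) (c : ℝ)
    (X Y : Site d → Fin d → Matrix n n ℂ) : hess V (c • X) Y W = c * hess V X Y W := by
  simp only [hess, hessPlaq, hessPlaqAt_smul_left, Finset.mul_sum]

/-- `hess V X Y W` is `ℝ`-homogeneous in `Y`. [folklore] -/
theorem hess_smul_right (V : Site d → Fin d → (Matrix n n ℂ)ˣ) (W : Finset (T4AveragingDeficitWall.Plaq d)) (c : ℝ)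
    (X Y : Site d → Fin d → Matrix n n ℂ) : hess V X (c • Y) W = c * hess V X Y W := by
  simp only [hess, hessPlaq, hessPlaqAt_smul_right, Finset.mul_sum]

/-! ## §2 The Hessian as a bilinear map and its symmetrisation -/

/-- **THE WILSON HESSIAN AS AN `ℝ`-BILINEAR MAP** on direction fields: `hessBilin V W X Y = hess V X Y W`
(`= ∂_s∂_t|₀ A_W((V e^{sX}) e^{tY})`, `NE3HessForm.hasDerivAt_dAction_vary`). [folklore] -/
def hessBilin (V : Site d → Fin d → (Matrix n n ℂ)ˣ) (W : Finset (T4AveragingDeficitWall.Plaq d)) :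
    (Site d → Fin d → Matrix n n ℂ) →ₗ[ℝ] (Site d → Fin d → Matrix n n ℂ) →ₗ[ℝ] ℝ :=
  LinearMap.mk₂ ℝ (fun X Y => hess V X Y W) (fun X₁ X₂ Y => hess_add_left V W X₁ X₂ Y)
    (fun c X Y => by rw [smul_eq_mul]; exact hess_smul_left V W c X Y) (fun X Y₁ Y₂ => hess_add_right V W X Y₁ Y₂)
    (fun c X Y => by rw [smul_eq_mul]; exact hess_smul_right V W c X Y)

/-- `hessBilin V W X Y = hess V X Y W`. [folklore] -/
@[simp] theorem hessBilin_apply (V : Site d → Fin d → (Matrix n n ℂ)ˣ) (W : Finset (T4AveragingDeficitWall.Plaq d))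
    (X Y : Site d → Fin d → Matrix n n ℂ) : hessBilin V W X Y = hess V X Y W := rfl

/-- **THE SYMMETRISED HESSIAN** `hessSym V W := ½(hessBilin V W + (hessBilin V W).flip)` — the `Hs t` of
`NE3EnergyAssembly.RouteLeaves` at the configuration `V = W_t` (the ordered mixed derivative `hess V X Y` is not
symmetric away from critical `V`; the quadratic form, which is all that `split`∕`coer` use, is unchanged). [folklore] -/
def hessSym (V : Site d → Fin d → (Matrix n n ℂ)ˣ) (W : Finset (T4AveragingDeficitWall.Plaq d)) :
    (Site d → Fin d → Matrix n n ℂ) →ₗ[ℝ] (Site d → Fin d → Matrix n n ℂ) →ₗ[ℝ] ℝ :=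
  (2 : ℝ)⁻¹ • (hessBilin V W + (hessBilin V W).flip)

/-- `hessSym V W X Y = (hess V X Y W + hess V Y X W)/2`. [folklore] -/
theorem hessSym_apply (V : Site d → Fin d → (Matrix n n ℂ)ˣ) (W : Finset (T4AveragingDeficitWall.Plaq d))
    (X Y : Site d → Fin d → Matrix n n ℂ) : hessSym V W X Y = (hess V X Y W + hess V Y X W) / 2 := by
  simp only [hessSym, LinearMap.smul_apply, LinearMap.add_apply, LinearMap.flip_apply, hessBilin_apply, smul_eq_mul]
  ring

/-- `hessSym` IS SYMMETRIC (field `symm` of `RouteLeaves`). [folklore] -/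
theorem hessSym_symm (V : Site d → Fin d → (Matrix n n ℂ)ˣ) (W : Finset (T4AveragingDeficitWall.Plaq d))
    (X Y : Site d → Fin d → Matrix n n ℂ) : hessSym V W X Y = hessSym V W Y X := by
  rw [hessSym_apply, hessSym_apply, add_comm]

/-- On the diagonal the symmetrisation is the Hessian itself: `hessSym V W X X = hess V X X W`. [folklore] -/
theorem hessSym_self (V : Site d → Fin d → (Matrix n n ℂ)ˣ) (W : Finset (T4AveragingDeficitWall.Plaq d))
    (X : Site d → Fin d → Matrix n n ℂ) : hessSym V W X X = hess V X X W := by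
  rw [hessSym_apply]; ring

/-! ## §3 The fields `act ∕ d1 ∕ d2 ∕ symm ∕ split` of `RouteLeaves` from leaf L3, together -/

/-- **ROW S5-Y8 PART 1 — THE C²∕HESSIAN FIELDS OF `RouteLeaves`, DISCHARGED TOGETHER.**  For a background `W`, a
window `Wn`, a general path `Γ` with velocity data `(Ψ, Ψ′)` (`hE`, `hΨ` as in
`NE3EnergyPathC2.hasDerivAt_two_fineAction_path`; dischargeable for bondwise C² paths by
`NE3EnergyPathC2Velocity.exists_velocities_of_contDiff`) and ANY tangent datum `X`, put `W_t := vary W (Γ t) 1`,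
`φ t := A_{Wn}(W_t)`, `φ′ t := dAction W_t (Ψ t) Wn`, `φ″ t := hess W_t (Ψ t) (Ψ t) Wn + dAction W_t (Ψ′ t) Wn`,
`Hs t := hessSym W_t Wn`, `uu t := Ψ t − X`, `e t := dAction W_t (Ψ′ t) Wn`.  THEN the five fields
`act`, `d1`, `d2`, `symm`, `split` of `NE3EnergyAssembly.RouteLeaves` hold verbatim (with `W := cavg L U_B`,
`Wn := perWin d (N·L^k)` there).  The remaining fields (L1, L2, L5, L6, L7, L9) are untouched. [folklore] -/
theorem c2_split_fields (W : Site d → Fin d → (Matrix n n ℂ)ˣ) {Γ Ψ Ψ' : ℝ → Site d → Fin d → Matrix n n ℂ}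
    (hE : ∀ t y κ, HasDerivAt (fun s => exp (Γ s y κ)) (exp (Γ t y κ) * Ψ t y κ) t)
    (hΨ : ∀ t y κ, HasDerivAt (fun s => Ψ s y κ) (Ψ' t y κ) t)
    (Wn : Finset (T4AveragingDeficitWall.Plaq d)) (X : Site d → Fin d → Matrix n n ℂ) :
    (∀ t : ℝ, (fun s : ℝ => fineAction (vary W (Γ s) 1) Wn) t = fineAction (vary W (Γ t) 1) Wn) ∧
    (∀ t ∈ Set.Icc (0 : ℝ) 1, HasDerivAt (fun s : ℝ => fineAction (vary W (Γ s) 1) Wn)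
        ((fun s : ℝ => dAction (vary W (Γ s) 1) (Ψ s) Wn) t) t) ∧
    (∀ t ∈ Set.Icc (0 : ℝ) 1, HasDerivAt (fun s : ℝ => dAction (vary W (Γ s) 1) (Ψ s) Wn)
        ((fun s : ℝ => hess (vary W (Γ s) 1) (Ψ s) (Ψ s) Wn + dAction (vary W (Γ s) 1) (Ψ' s) Wn) t) t) ∧
    (∀ t ∈ Set.Icc (0 : ℝ) 1, ∀ x y : Site d → Fin d → Matrix n n ℂ,
        (fun s : ℝ => hessSym (vary W (Γ s) 1) Wn) t x y = (fun s : ℝ => hessSym (vary W (Γ s) 1) Wn) t y x) ∧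
    (∀ t ∈ Set.Icc (0 : ℝ) 1,
        (fun s : ℝ => hess (vary W (Γ s) 1) (Ψ s) (Ψ s) Wn + dAction (vary W (Γ s) 1) (Ψ' s) Wn) t
          = (fun s : ℝ => hessSym (vary W (Γ s) 1) Wn) t (X + (fun s => Ψ s - X) t) (X + (fun s => Ψ s - X) t)
            + (fun s : ℝ => dAction (vary W (Γ s) 1) (Ψ' s) Wn) t) := by
  refine ⟨fun t => rfl, fun t _ => (hasDerivAt_two_fineAction_path W hE hΨ Wn t).1,
    fun t _ => (hasDerivAt_two_fineAction_path W hE hΨ Wn t).2, fun t _ x y => hessSym_symm _ _ x y, fun t _ => ?_⟩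
  simp only [add_sub_cancel, hessSym_self]

/-! ## §4 The field `res` from row Y9's output shape -/

/-- At the END TIME the path sits at `W_1 = vary W (Γ 1) 1` and `φ′ 1 = dAction W_1 (Ψ 1) Wn` is ITSELF a derivative at
`0` of the straight perturbation `s ↦ A_{Wn}(W_1 e^{sΨ_1})` (`NE3HessForm.hasDerivAt_fineAction_vary_at` at `s = 0`); so
ANY bound of row Y9's shape «`∀ D, HasDerivAt (s ↦ A_{Wn}(W_1 e^{sΨ_1})) D 0 → |D| ≤ r·E`»
(`NE3EnergyResidual.abs_deriv_action_le_residualScale` with `X := Ψ 1`, `E := energyNorm W_1 (Ψ 1) …`) gives the field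
`res : φ′ 1 ≤ r·E` of `RouteLeaves` (for the tangent datum `X := Ψ 1 = Γ′(1)`, cf. `NE3EnergyPathC2Velocity.rvel_of_base`).
[folklore] -/
theorem res_field (W : Site d → Fin d → (Matrix n n ℂ)ˣ) (Γ Ψ : ℝ → Site d → Fin d → Matrix n n ℂ)
    (Wn : Finset (T4AveragingDeficitWall.Plaq d)) {r E : ℝ}
    (hY9 : ∀ D : ℝ, HasDerivAt (fun s : ℝ => fineAction (vary (vary W (Γ 1) 1) (Ψ 1) s) Wn) D 0 → |D| ≤ r * E) :
    (fun s : ℝ => dAction (vary W (Γ s) 1) (Ψ s) Wn) 1 ≤ r * E := by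
  have hD := NE3HessForm.hasDerivAt_fineAction_vary_at (vary W (Γ 1) 1) (Ψ 1) Wn 0
  rw [vary_zero] at hD
  exact (le_abs_self _).trans (hY9 _ hD)

/-- The same with the end-point condition `endW : Γ 1 = 0` of `RouteLeaves` (`W_1 = W`): Y9's bound AT THE BACKGROUND
`W` itself, for the direction `Ψ 1`, gives `res`. [folklore] -/
theorem res_field_of_endW (W : Site d → Fin d → (Matrix n n ℂ)ˣ) (Γ Ψ : ℝ → Site d → Fin d → Matrix n n ℂ)
    (hend : Γ 1 = 0) (Wn : Finset (T4AveragingDeficitWall.Plaq d)) {r E : ℝ}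
    (hY9 : ∀ D : ℝ, HasDerivAt (fun s : ℝ => fineAction (vary W (Ψ 1) s) Wn) D 0 → |D| ≤ r * E) :
    (fun s : ℝ => dAction (vary W (Γ s) 1) (Ψ s) Wn) 1 ≤ r * E := by
  refine res_field W Γ Ψ Wn fun D hD => hY9 D ?_
  have hW : vary W (Γ 1) 1 = W := by rw [hend]; exact vary_zero_dir W 1
  simpa only [hW] using hD

end

end Summit.QuantumFields.BalabanUV.T4Continuum.NE3EnergyHessBilin
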